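import Literature.MathematicalPhysics.QuantumFieldTheory.Balaban1983to89.B15Sect1ChartInstances
import Literature.MathematicalPhysics.QuantumFieldTheory.Balaban1983to89.B16Sect1Backgrounds
import Literature.MathematicalPhysics.QuantumFieldTheory.Balaban1983to89.B15Sect1Statements

/-!
# `Balaban1983to89.B16Eq119ChartDictionary` — T. Bałaban, *Large field renormalization. II. Localization,
# exponentiation, and bounds for the 𝐑 operation*, Commun. Math. Phys. **122** (1989) 355–392 [Balaban1989LargeFieldII]
# = «[V]», (1.19) p. 360 and (1.50) p. 370: the data of the new background fields ARE the objects (1.81)–(1.82) of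
# *Large field renormalization. I*, CMP **122** (1989) 175–202 [Balaban1989LargeFieldI] = «[IV]» — the dictionary between
# the two exponential-chart structures of the tree and the junctions it yields

statement-level skeleton of published theorems with citation tags; proofs where landed; nothing here is a claim about
the Yang–Mills mass gap

PDFs held: `paper:balaban1989-cmp122-large-field-ii` (journal page = PDF page + 354; p. 360 [PDF 6] L32–35 and p. 370
[PDF 16] L3 read on the text layer 2026-08-25) and `paper:balaban1989-cmp122-large-field-i` (journal page = PDF page
+ 174; (1.81) p. 195 [PDF 21] L27, (1.82) p. 196 [PDF 22] L36–37).

CITATION HEADER / WHAT IS REPRODUCED (mega-formalization `lit-balaban`, HOME `run/shared/lean/pub/lit-balaban/`; unit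
`lit-balaban-r20` gen 74, DEFINITIONS steward; register pair **H44** of `lit-balaban-r20/DEFINITIONS.md` v1.97 (ii),
hub-checked there on a scratch twin and filed here with imports now that p29's `B15Sect1ChartInstances` (p386208 ✓)
is in the tree).  SKELETON rows served (cells only, no head): **B16.Eq1.19**, **B16.Eq1.50** (owner r13), **B15.Eq1.81**,
**B15.Eq1.82**, **B15.Eq1.85-1.86**, **B15.Eq1.92-1.93**, **B15.Eq1.97**, **B15.Eq1.101** (owner r12, PROXY r11 ∕ p29).

THE PRINT.  [V] p. 360, before (1.19): *"The configuration U″_{k,Z} depends on V″, which is decomposed into V′V₀ on 𝐁₀,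
according to (1.81) [IV]. The field V′ = exp ig_kB is small, more precisely |B| < g_k⁻¹δ′_k by the restrictions (1.82)
[IV] in the characteristic function χ′, hence we have U″_{k,Z} = U″_{k,Z}(exp ig_kB M˙(U₀)↾_{Ω″^{∼2}_{h+1}},
V″↾_{(Ω″^{∼2}_{h+1})ᶜ}) (1.19)"*; p. 370: *"U″_k = U_{𝐁″_k}(V″↾_{Λᶜ}, exp ig_kB M˙(U₀^{(AL)})↾_{Λ∩Ω″^{∼2}_{h+1}},
V″↾_{(Ω″^{∼2}_{h+1})ᶜ}) (1.50)"*.  [IV] p. 195: *"V″ = V′V₀ on Λ₀, V₀ = M_{𝔹″_k}(U₀) (1.81)"*, *"denote Λ₀ =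
Λ∩Ω″^{∼2}_{h+1}"*; p. 196: *"χ′ = χ({|B′(b)| < δ′_k for b∈𝔹₀}) (1.82) and V′ = exp iB′"*.

THE TWO CHART STRUCTURES OF THE TREE.  [IV] §1 is typed over r12's `B15StandardRep.LieChart G 𝔤` (bare data
`expI`, `logI`; letters `expMul χ s A U = exp(i s A)·U`, `logRatio χ V W = (1/i) log[V W⁻¹]`), and p29's
`B15Sect1ChartInstances` pins (1.81)–(1.82) to it (`v0std181`, `vPrime181`, `bPrime181`, `vOfB182`, `vDoublePrime182`,
`chiPrime182std`, `lambda0`); [V] §1 is typed over r13's `B16Sect1Backgrounds.ExpChart G 𝔤` (data `iexp`, `ilog` + the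
two normalisations `iexp 0 = 1`, `ilog 1 = 0`; letters `expMul ch A U` with no scaling letter, `msExpMul`, `ilogRatio`,
`msILogRatio`, `msMul`, `msInv`), and the ONLY place print uses (1.81)–(1.82) downstream — (1.19) and (1.50) — is r13's
`Sect1Data.data119` ∕ `data150` over `ExpChart`.  This file is the dictionary; nothing is re-declared.

WHAT IS PROVED (one forgetful `def` + theorems; 0 `def … : Prop` facts, 0 `sorry`, standard axioms).
§1 **`toLieChart : ExpChart G 𝔤 → LieChart G 𝔤`** (forget the two normalisations) with `toLieChart_expI` ∕ `_logI`
   (rfl) and the laws read through (`toLieChart_expI_zero`, `toLieChart_logI_one`); **`expMul16_eq_expMul15`** (r13's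
   `expMul ch A U` = r12's `expMul (toLieChart ch) 1 A U`), `expMul15_eq_expMul16` (r12's general `s` = r13's at `s • A`,
   rfl), **`msILogRatio_eq_logRatio`** (rfl), `ilogRatio_apply_eq`, `msExpMul_apply`.
§2 p29's (1.81)–(1.82) objects IN r13's letters: `v0std181_eq_avgFamily` (rfl), **`vPrime181_eq_msMul_msInv`** (rfl),
   **`bPrime181_eq_msILogRatio`** (rfl), **`vDoublePrime182_eq_msExpMul`**, `vOfB182_eq_msExpMul_one`.
§3 THE PRINT JUNCTIONS [V] ← [IV]: **`data119_eq`** — `D.data119 B = splice D.ΩppT2 (vDoublePrime182 (toLieChart D.ch) av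
   (D.gk • B) D.U₀) D.Vpp` ((1.19)'s datum IS (1.82)'s `V″ = exp(ig_kB)·V₀` on `Ω″^{∼2}_{h+1}`, `V″` elsewhere);
   **`data150_eq`** — `D.data150 B = splice (lambda0 D.Λ D.ΩppT2) (vDoublePrime182 (toLieChart D.ch) av (D.gk • B)
   D.U0AL) D.Vpp` ((1.50)'s datum IS `exp(ig_kB)·M˙(U₀^{(AL)})` on print's `Λ₀` = p29's `lambda0`, which r13 writes inline
   as `D.Λ ∩ D.ΩppT2`); `data119_zero` ∕ `data150_zero` (at `B = 0` the data are the plain averages — r13's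
   `msExpMul_zero`, his `bg0kZ_eq` ∕ `bg0k_eq` one level down); and the p. 360 smallness sentence *"more precisely
   |B| < g_k⁻¹δ′_k by the restrictions (1.82) [IV]"* PROVED from p29's `chiPrime182std` at `B′ = g_kB`, `g_k > 0`
   (**`norm_lt_of_chiPrime182std_smul`**, `chiPrime182std_smul_iff`).
§4 r12's own schema letters at the (1.81)–(1.82) objects (same chart, junctions only): **`rep185_iff_v0std181`** ((1.85)
   `Rep185 av sol U₀ ↔ U₀ = sol (v0std181 av U₀)`, Iff.rfl), **`rep192_iff_of_vPrime181`** ((1.92)'s first equality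
   `V″ = V′M^h(U₀)` is AUTOMATIC for `V′ := vPrime181`; what (1.92) asserts beyond (1.81) is its second member),
   **`cfg197_eq`** ((1.97)'s spliced datum at `MU0 := V₀` is, off `Σ`, exactly `V″ = (exp iB′)V₀ = vDoublePrime182`).
§5 (1.101): r12's `{0,1}`-density `B15Sect1Statements.chi101Density` (over a `Finset` bond range and an abstract size
   letter) and p29's indicator `ind1101` (over the `Set` range `bondsOf (pts k Λ_i)` at the chart size letter
   `‖(1/i) log ·‖`) AGREE: **`chi101Density_eq_ind1101`**.

HONEST SCOPE.  (i) Pure dictionary: every statement but the p. 360 smallness sentence (`norm_smul`) is definitional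
(`rfl`, `funext`, `one_smul`, `mul_one`, `if_congr`) — the content is that the two readers' carriers denote the same printed objects, so that [V] §1 assemblies
can consume [IV] §1's instances by name.  (ii) The forgetful map goes `ExpChart → LieChart` only; an `ExpChart` cannot be
built from a bare `LieChart` (no laws), and none is.  (iii) No analytic property of the chart (`log ∘ exp = id` near `1`,
smallness transfer `|V′ − 1| ↔ |B′|`) is asserted — those stay the located hypotheses of `B15Sect1ChartInstances`
(HONEST SCOPE (i) there) and of r13's `IsRepr`.  (iv) No SKELETON head moves: the rows above keep their owners' heads.
-/

noncomputable section

namespace Literature.MathematicalPhysics.QuantumFieldTheory.Balaban1983to89.B16Eq119ChartDictionary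

open Literature.MathematicalPhysics.QuantumFieldTheory.Balaban1983to89
open B15DeterminingSets B15.PrelimIntegrations B15StandardRep B15Sect1ChartInstances GaugeField
open Set

variable {P : Params} {G : Type*} [GaugeGroup G] {𝔤 : Type*} [NormedAddCommGroup 𝔤] [NormedSpace ℝ 𝔤]
variable {av : ∀ j, Averaging P j G}

/-! ## §1 The dictionary: every `ExpChart` of [V] §1 IS a `LieChart` of [IV] §1 (forget the two normalisations) -/

section Dict

variable (ch : B16Sect1Backgrounds.ExpChart G 𝔤)

/-- The forgetful map from r13's [V] chart structure (`iexp`, `ilog`, `iexp 0 = 1`, `ilog 1 = 0`) to r12's [IV] chart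
data (`expI`, `logI`): the SAME pair of maps *"V′ = exp ig_kB"* ∕ *"(1/i) log"* of p. 360, laws forgotten.
[cite: Balaban1989LargeFieldII, (1.19) p.360] -/
def toLieChart : LieChart G 𝔤 := ⟨ch.iexp, ch.ilog⟩

/-- `expI` of the dictionary chart is `iexp` (definitional). [cite: Balaban1989LargeFieldII, (1.19) p.360] -/
@[simp] theorem toLieChart_expI (A : 𝔤) :
    (toLieChart ch).expI A = ch.iexp A := rfl

/-- `logI` of the dictionary chart is `ilog` (definitional). [cite: Balaban1989LargeFieldII, (1.19) p.360] -/
@[simp] theorem toLieChart_logI (g : G) :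
    (toLieChart ch).logI g = ch.ilog g := rfl

/-- The first `ExpChart` law read through the dictionary: `exp(i0) = 1`. [cite: Balaban1989LargeFieldII, (1.19) p.360] -/
theorem toLieChart_expI_zero : (toLieChart ch).expI 0 = 1 := ch.iexp_zero

/-- The second `ExpChart` law read through the dictionary: `(1/i) log 1 = 0`. [cite: Balaban1989LargeFieldII, (1.19) p.360] -/
theorem toLieChart_logI_one : (toLieChart ch).logI 1 = 0 := ch.ilog_one

/-- r13's `expMul ch A U = exp(iA)·U` (no scaling letter) IS r12's `expMul χ s A U = exp(i s A)·U` at `s = 1` through the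
dictionary. [cite: Balaban1989LargeFieldII, (1.19) p.360] -/
theorem expMul16_eq_expMul15 {j : ℕ} (A : VecField P j 𝔤) (U : GaugeField P j G) :
    B16Sect1Backgrounds.expMul ch A U = expMul (toLieChart ch) 1 A U := by
  funext b
  simp only [B16Sect1Backgrounds.expMul, expMul, one_smul]
  rfl

/-- … and r12's general scaling letter `s` is r13's `expMul` at `s • A` (definitional).
[cite: Balaban1989LargeFieldI, (1.30) p.183] -/
theorem expMul15_eq_expMul16 {j : ℕ} (s : ℝ) (A : VecField P j 𝔤) (U : GaugeField P j G) :
    expMul (toLieChart ch) s A U = B16Sect1Backgrounds.expMul ch (s • A) U := rfl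

/-- r13's multi-scale `msExpMul`, bondwise: `exp(iA_j(b))·V_j(b)` (definitional). [cite: Balaban1989LargeFieldII, (1.19) p.360] -/
theorem msExpMul_apply (A : B16Sect1Backgrounds.MSVecField P 𝔤) (V : MSField P G) (j : ℕ) (b : PBond P j) :
    B16Sect1Backgrounds.msExpMul ch A V j b = ch.iexp (A j b) * V j b := rfl

/-- r13's multi-scale `(1/i) log[W V⁻¹]` IS r12's `logRatio` through the dictionary (definitional) — the argument fields
*"(1/i) log[M˙(U″_k)(M˙(Q_k^{s*}V_k))⁻¹]"* of (1.16). [cite: Balaban1989LargeFieldII, (1.16) p.360] -/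
theorem msILogRatio_eq_logRatio (W V : MSField P G) :
    B16Sect1Backgrounds.msILogRatio ch W V = logRatio (toLieChart ch) W V := rfl

/-- One-scale version, bondwise. [cite: Balaban1989LargeFieldII, (1.16) p.360] -/
theorem ilogRatio_apply_eq {j : ℕ} (W V : GaugeField P j G) (b : PBond P j) :
    B16Sect1Backgrounds.ilogRatio ch W V b = (toLieChart ch).logI (W b * (V b)⁻¹) := rfl

end Dict

/-! ## §2 p29's (1.81)–(1.82) objects in r13's [V] §1 letters -/

section Objects

variable (ch : B16Sect1Backgrounds.ExpChart G 𝔤) (av)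

/-- (1.81) `V₀ = M_{𝔹″_k}(U₀)`: p29's `v0std181 av U₀` IS r13's ∕ r12's `avgFamily av U₀` (an alias, definitional).
[cite: Balaban1989LargeFieldI, (1.81) p.195] -/
theorem v0std181_eq_avgFamily (U₀ : GaugeField P 0 G) : v0std181 av U₀ = avgFamily av U₀ := rfl

/-- (1.81) `V′ = V″V₀⁻¹`: p29's `vPrime181` IS r13's `msMul V″ (msInv (M˙(U₀)))` (definitional).
[cite: Balaban1989LargeFieldI, (1.81) p.195] -/
theorem vPrime181_eq_msMul_msInv (V'' : MSField P G) (U₀ : GaugeField P 0 G) :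
    vPrime181 av V'' U₀ = B16Sect1Backgrounds.msMul V'' (B16Sect1Backgrounds.msInv (avgFamily av U₀)) := rfl

/-- (1.82) `B′ = (1/i) log[V″V₀⁻¹]`: p29's `bPrime181` in the dictionary chart IS r13's `msILogRatio ch V″ (M˙(U₀))`
(definitional). [cite: Balaban1989LargeFieldI, (1.82) p.196] -/
theorem bPrime181_eq_msILogRatio (V'' : MSField P G) (U₀ : GaugeField P 0 G) :
    bPrime181 (toLieChart ch) av V'' U₀ = B16Sect1Backgrounds.msILogRatio ch V'' (avgFamily av U₀) := rfl

/-- (1.81)–(1.82) `V″ = (exp iB′)V₀`: p29's `vDoublePrime182` in the dictionary chart IS r13's `msExpMul ch B′ (M˙(U₀))`.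
[cite: Balaban1989LargeFieldI, (1.82) p.196] -/
theorem vDoublePrime182_eq_msExpMul (B' : (j : ℕ) → VecField P j 𝔤) (U₀ : GaugeField P 0 G) :
    vDoublePrime182 (toLieChart ch) av B' U₀ = B16Sect1Backgrounds.msExpMul ch B' (avgFamily av U₀) := by
  funext j b
  rw [vDoublePrime182_apply]
  rfl

/-- (1.82) `V′ = exp iB′`: p29's `vOfB182` in the dictionary chart IS r13's `msExpMul ch B′ 1`.
[cite: Balaban1989LargeFieldI, (1.82) p.196] -/
theorem vOfB182_eq_msExpMul_one (B' : (j : ℕ) → VecField P j 𝔤) :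
    vOfB182 (toLieChart ch) B' = B16Sect1Backgrounds.msExpMul ch B' 1 := by
  funext j b
  show ch.iexp (B' j b) = ch.iexp (B' j b) * 1
  rw [mul_one]

end Objects

/-! ## §3 The print junctions: [V] (1.19) and (1.50) data ARE [IV] (1.81)–(1.82)'s `V″` -/

section Junctions

variable (D : B16Sect1Backgrounds.Sect1Data P G av 𝔤)

/-- **[V] (1.19) p. 360**, verbatim: *"V″, which is decomposed into V′V₀ on 𝐁₀, according to (1.81) [IV]. The field
V′ = exp ig_kB is small … hence we have U″_{k,Z} = U″_{k,Z}(exp ig_kB M˙(U₀)↾_{Ω″^{∼2}_{h+1}}, V″↾_{(Ω″^{∼2}_{h+1})ᶜ}) (1.19)"*: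
r13's datum `data119 B` IS (1.82)'s `V″ := exp(i g_k B)·V₀` (p29's `vDoublePrime182` in the dictionary chart, at the
scaled variable `B′ = g_kB`) on `Ω″^{∼2}_{h+1}`, `V″` elsewhere. [cite: Balaban1989LargeFieldII, (1.19) p.360] -/
theorem data119_eq (B : B16Sect1Backgrounds.MSVecField P 𝔤) :
    D.data119 B = splice D.ΩppT2 (vDoublePrime182 (toLieChart D.ch) av (D.gk • B) D.U₀) D.Vpp := by
  rw [vDoublePrime182_eq_msExpMul]
  rfl

/-- **[V] (1.50) p. 370**, verbatim: *"U″_k = U_{𝐁″_k}(V″↾_{Λᶜ}, exp ig_kB M˙(U₀^{(AL)})↾_{Λ∩Ω″^{∼2}_{h+1}},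
V″↾_{(Ω″^{∼2}_{h+1})ᶜ}) (1.50)"*: r13's datum `data150 B` IS `exp(i g_k B)·M˙(U₀^{(AL)})` (p29's `vDoublePrime182` at
`U₀^{(AL)}`) on print's `Λ₀ = Λ∩Ω″^{∼2}_{h+1}` of [IV] p. 195 — p29's `lambda0`, which r13 writes inline as `D.Λ ∩ D.ΩppT2`
— and `V″` elsewhere. [cite: Balaban1989LargeFieldII, (1.50) p.370] -/
theorem data150_eq (B : B16Sect1Backgrounds.MSVecField P 𝔤) :
    D.data150 B = splice (lambda0 D.Λ D.ΩppT2) (vDoublePrime182 (toLieChart D.ch) av (D.gk • B) D.U0AL) D.Vpp := by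
  rw [vDoublePrime182_eq_msExpMul]
  rfl

/-- (1.19) at `B = 0` — p. 360, verbatim: *"We denote the new background field by U⁰_{k,Z}"* (r13's `bg0kZ`, the
configuration of (1.19) at `B = 0`): its datum is the plain average `M˙(U₀)` on `Ω″^{∼2}_{h+1}`, `V″` elsewhere (the
`ExpChart` law `exp(i0) = 1`, r13's `msExpMul_zero`; = his `bg0kZ_eq` one level down, at the data).
[cite: Balaban1989LargeFieldII, (1.19) p.360] -/
theorem data119_zero : D.data119 0 = splice D.ΩppT2 (avgFamily av D.U₀) D.Vpp := by
  simp only [B16Sect1Backgrounds.Sect1Data.data119, smul_zero, B16Sect1Backgrounds.msExpMul_zero]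

/-- (1.50) at `B = 0` — p. 370 after (1.51), verbatim: *"where U⁰_k is the configuration in (1.50) with B = 0"*: its datum
is `M˙(U₀^{(AL)})` on print's `Λ₀` (p29's `lambda0`), `V″` elsewhere (= r13's `bg0k_eq` one level down, at the data).
[cite: Balaban1989LargeFieldII, (1.51) p.370] -/
theorem data150_zero : D.data150 0 = splice (lambda0 D.Λ D.ΩppT2) (avgFamily av D.U0AL) D.Vpp := by
  simp only [B16Sect1Backgrounds.Sect1Data.data150, smul_zero, B16Sect1Backgrounds.msExpMul_zero]
  rfl

/-- **[V] p. 360**, the smallness sentence before (1.19), verbatim: *"The field V′ = exp ig_kB is small, more precisely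
|B| < g_k⁻¹δ′_k by the restrictions (1.82) [IV] in the characteristic function χ′"* — PROVED from p29's instance of
(1.82): if `χ′` ((1.82), `chiPrime182std … δ′_k`) holds at the chart variable `B′ = g_kB` with `g_k > 0`, then
`|B(b)| < g_k⁻¹δ′_k` on every bond of `𝔹₀` (every scale). [cite: Balaban1989LargeFieldII, (1.19) p.360] -/
theorem norm_lt_of_chiPrime182std_smul (Ω Zpp : ℕ → Set (Site P 0)) (Z Λ ΩppT2 : Set (Site P 0)) (h k : ℕ)
    {gk δ'k : ℝ} (hgk : 0 < gk) {B : B16Sect1Backgrounds.MSVecField P 𝔤}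
    (hχ : chiPrime182std Ω Zpp Z Λ ΩppT2 h k δ'k (gk • B)) (j : ℕ) {b : PBond P j}
    (hb : b ∈ bondsB0 Ω Zpp Z Λ ΩppT2 h k j) : ‖B j b‖ < gk⁻¹ * δ'k := by
  have h1 : ‖(gk • B) j b‖ < δ'k := hχ j b hb
  have h2 : ‖(gk • B) j b‖ = gk * ‖B j b‖ := by
    rw [Pi.smul_apply, Pi.smul_apply, norm_smul, Real.norm_of_nonneg hgk.le]
  rw [h2] at h1
  rw [lt_inv_mul_iff₀ hgk]
  exact h1

/-- … and conversely: `|B| < g_k⁻¹δ′_k` on the bonds of `𝔹₀` gives `χ′ = 1` at `B′ = g_kB` — the two smallness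
statements of p. 360 are EQUIVALENT for `g_k > 0`. [cite: Balaban1989LargeFieldII, (1.19) p.360] -/
theorem chiPrime182std_smul_iff (Ω Zpp : ℕ → Set (Site P 0)) (Z Λ ΩppT2 : Set (Site P 0)) (h k : ℕ)
    {gk : ℝ} (hgk : 0 < gk) (δ'k : ℝ) (B : B16Sect1Backgrounds.MSVecField P 𝔤) :
    chiPrime182std Ω Zpp Z Λ ΩppT2 h k δ'k (gk • B) ↔
      ∀ j, ∀ b ∈ bondsB0 Ω Zpp Z Λ ΩppT2 h k j, ‖B j b‖ < gk⁻¹ * δ'k := by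
  refine ⟨fun hχ j b hb => norm_lt_of_chiPrime182std_smul Ω Zpp Z Λ ΩppT2 h k hgk hχ j hb, fun hB j b hb => ?_⟩
  show ‖(gk • B) j b‖ < δ'k
  rw [Pi.smul_apply, Pi.smul_apply, norm_smul, Real.norm_of_nonneg hgk.le, ← lt_inv_mul_iff₀ hgk]
  exact hB j b hb

end Junctions

/-! ## §4 r12's own (1.85) ∕ (1.92) ∕ (1.97) schema letters at the (1.81)–(1.82) objects -/

section Schema

variable (χ : LieChart G 𝔤) (av)

/-- **(1.85)** p. 197 *"U₀ = U(𝔹_k(Λ), M˙(U₀))"*: r12's `Rep185` (with `M˙(U₀)` inline) at p29's `V₀ = v0std181 av U₀`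
(Iff.rfl). [cite: Balaban1989LargeFieldI, (1.85) p.197] -/
theorem rep185_iff_v0std181 (sol : ((j : ℕ) → GaugeField P j G) → GaugeField P 0 G) (U₀ : GaugeField P 0 G) :
    Rep185 av sol U₀ ↔ U₀ = sol (v0std181 av U₀) := Iff.rfl

omit [NormedAddCommGroup 𝔤] [NormedSpace ℝ 𝔤] in
/-- **(1.92)** p. 198 *"V″ = V′M^h(U₀^{(AL)}) = exp iB′ exp iQ̃_h(η𝔸₀)"*: for `V′ := vPrime181` (i.e. (1.81) read as a
definition) the FIRST equality of r12's `Rep192` is automatic (p29's `vPrime181_mul_v0`); what (1.92) asserts beyond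
(1.81) is its second member. [cite: Balaban1989LargeFieldI, (1.92) p.198] -/
theorem rep192_iff_of_vPrime181 {hh : ℕ} (S : Set (PBond P hh)) (V'' : MSField P G) (U₀ : GaugeField P 0 G)
    (Bp Qt : VecField P hh 𝔤) :
    Rep192 χ S (V'' hh) (vPrime181 av V'' U₀ hh) (v0std181 av U₀ hh) Bp Qt ↔
      ∀ b ∈ S, V'' hh b = χ.expI (Bp b) * χ.expI (Qt b) := by
  refine forall₂_congr fun b _ => ?_
  rw [vPrime181_mul_v0]
  exact and_iff_right rfl

open Classical in
/-- **(1.97)** p. 199: r12's spliced datum `cfg197` at `MU0 := V₀ = M˙(U₀)` is, OFF the layer `Σ`, exactly (1.81)–(1.82)'s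
`V″ = (exp iB′)V₀ = vDoublePrime182 χ av B′ U₀`, and `V₀` on `Σ`. [cite: Balaban1989LargeFieldI, (1.97) p.199] -/
theorem cfg197_eq (sol : ((j : ℕ) → GaugeField P j G) → GaugeField P 0 G) (Sig : (j : ℕ) → Set (PBond P j))
    (Bp : (j : ℕ) → VecField P j 𝔤) (U₀ : GaugeField P 0 G) :
    cfg197 χ sol Sig Bp (v0std181 av U₀) =
      sol (fun j b => if b ∈ Sig j then v0std181 av U₀ j b else vDoublePrime182 χ av Bp U₀ j b) := by
  unfold cfg197
  congr 1
  funext j b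
  split_ifs with hb
  · rfl
  · rw [vDoublePrime182_apply]; rfl

end Schema

/-! ## §5 (1.101): r12's `{0,1}`-density = p29's indicator at the chart size letter -/

section D1101

variable (χ : LieChart G 𝔤) (Λi : Set (Site P 0)) {k : ℕ}

omit [GaugeGroup G] [NormedSpace ℝ 𝔤] in
open Classical in
/-- **(1.101)** p. 201 *"χ(Λ_i) = χ({|(1/i) log V′(b)| ≤ M₀ε_k for b ∈ Λ_i})"*: r12's `{0,1}`-valued density
`chi101Density` (abstract size letter `logV′`, `Finset` bond range; row B15.Eq1.101 member) taken at the chart size letter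
`‖(1/i) log ·‖` EQUALS p29's indicator `ind1101` whenever the finset presents the bond range `bondsOf (pts k Λ_i)` (the two
`if`s carry different `Decidable` instances, whence `if_congr`). [cite: Balaban1989LargeFieldI, (1.101) p.201] -/
theorem chi101Density_eq_ind1101 (Λf : Finset (PBond P k)) (hΛ : (↑Λf : Set (PBond P k)) = bondsOf (pts k Λi))
    (M₀ εk : ℝ) (V' : GaugeField P k G) :
    B15Sect1Statements.chi101Density (fun V b => ‖χ.logI (V b)‖) Λf M₀ εk V' = ind1101 χ Λi k M₀ εk V' := by
  simp only [B15Sect1Statements.chi101Density, ind1101, chi101std, hΛ]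
  exact if_congr Iff.rfl rfl rfl

end D1101

end Literature.MathematicalPhysics.QuantumFieldTheory.Balaban1983to89.B16Eq119ChartDictionary

end
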